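import Literature.NumberTheory.Weil1965.LocalQuadraticFibreDensityDecay
import Literature.NumberTheory.Weil1964.LocalWeilIndexQuadraticForm
import HarnessLib

/-!
# Integrability of the Gauss transform of a diagonal quadratic form in `r ≥ 3` variables
(Weil 1965, Chap. I n° 2 and Chap. III n° 36 — finite places; file 2 of 3)

Topic `NumberTheory/Weil1965`; namespace `Literature.NumberTheory.Weil1965`.  KERNEL mathematics only (theorems; no
definition, no named fact, no `axiom`, no proof hole).  Sequel of `LocalQuadraticFibreDensityDecay.lean`.

`F` a non-archimedean local field, `μ` an additive Haar measure, `ψ` of conductor exponent `d`, `‖2‖ = q^{-v₂}`,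
`f(x) = Σᵢ cᵢ xᵢ²` a DIAGONAL non-degenerate form on `X = F^ι`, `Φ ∈ 𝒮(X)` Schwartz–Bruhat, and
`G_Φ(β) = ∫_X Φ(x) ψ(β f(x)) dμ^⊗ι` its Gauss transform (written out as `∫ x, Φ x * psiSqPi ψ (β • c) x ∂μ^⊗ι`).  This file:
`G_Φ` is CONTINUOUS (`continuous_integral_mul_psiSqPi`, dominated convergence) and, for `r = card ι ≥ 3`, INTEGRABLE on
`F` (`integrable_integral_mul_psiSqPi`): the decay `‖G_Φ(β)‖ ≤ C ‖β‖^{-r/2}` of the previous file summed over the shells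
`‖β‖ = q^k` (mass `∝ q^k`), a geometric series of ratio `q^{1-r/2} < 1` — Weil's integrability of `F*_Φ` [Weil1965, n° 36],
here for the hermitian rank-one Siegel–Weil range (`r = 2m = 6`).  Also: a Schwartz–Bruhat function on `F^ι` is integrable
for the product Haar measure.
Sequel: `LocalQuadraticFibreDensity.lean` (the continuous fibre density, Weil's Prop. 6).

## References

* [Weil1965] A. Weil, *Sur la formule de Siegel dans la théorie des groupes classiques*, Acta Math. 113 (1965) 1–87:
  Chap. I n° 2 Prop. 2 (p. 8); Chap. III n° 34–36, Prop. 6 (p. 54).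
* [Tate1950] J. Tate, *Fourier analysis in number fields and Hecke's zeta-functions* (1950), §2.2 Thm 2.2.2 (local
  Fourier inversion; tree file `TateSelfDualHaar`).
* [WeilBNT1967] A. Weil, *Basic Number Theory* (1967), Chap. VII §2 Prop. 2 (standard functions on `F^ι`).
* [BushnellHenniart2006] C. J. Bushnell, G. Henniart, *The local Langlands conjecture for GL(2)* (2006), §1.7.
-/

set_option autoImplicit false

noncomputable section

open MeasureTheory ValuativeRel Filter Topology Set
open scoped NNReal ENNReal Pointwise
open Literature.NumberTheory.GaloisRepresentations.IsNonarchimedeanLocalField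
open Literature.NumberTheory.Automorphic
open Literature.NumberTheory.Weil1964

namespace Literature.NumberTheory.Weil1965

variable {F : Type*} [Field F] [ValuativeRel F] [TopologicalSpace F] [IsNonarchimedeanLocalField F]

/-- `1 < √q`. [folklore] -/
private theorem one_lt_sqrt_residueFieldCard : (1 : ℝ) < Real.sqrt (residueFieldCard F) := by
  rw [Real.lt_sqrt zero_le_one, one_pow]
  exact_mod_cast one_lt_residueFieldCard F

/-- `0 < √q`. [folklore] -/
private theorem sqrt_residueFieldCard_pos : (0 : ℝ) < Real.sqrt (residueFieldCard F) :=
  zero_lt_one.trans one_lt_sqrt_residueFieldCard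


section GaussTransform

variable {ι : Type*} [Fintype ι] [MeasurableSpace F] [BorelSpace F] (μ : Measure F) [μ.IsAddHaarMeasure]
  {ψ : AddChar F Circle}



omit [BorelSpace F] [μ.IsAddHaarMeasure] in
/-- a Schwartz–Bruhat function on `F^ι` is integrable for the product Haar measure (take `β = 0` in the integrability
of `Φ ψ(β f)`). [cite: WeilBNT1967, Ch. VII §2, Prop. 2] -/
theorem integrable_of_mem_schwartzBruhat_pi [BorelSpace F] [μ.IsAddHaarMeasure] (hψ : Continuous ψ)
    {Φ : (ι → F) → ℂ} (hΦ : Φ ∈ SchwartzBruhat (ι → F)) : Integrable Φ (Measure.pi fun _ : ι => μ) := by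
  have h := integrable_mul_psiSqPi_of_mem_schwartzBruhat μ hψ (fun _ : ι => (0 : F)) hΦ 0
  refine h.congr (Eventually.of_forall fun x => ?_)
  simp only [mul_zero, psiSqPi_apply, zero_mul, Finset.sum_const_zero, AddChar.map_zero_eq_one, Circle.coe_one,
    mul_one]

/-- **the Gauss transform is continuous in `β`** (dominated convergence: the integrand is continuous in `β` and
dominated by `|Φ|`). [cite: Weil1965, Chap. I n° 2, p. 8] -/
theorem continuous_integral_mul_psiSqPi (hψ : Continuous ψ) (c : ι → F) {Φ : (ι → F) → ℂ}
    (hΦ : Φ ∈ SchwartzBruhat (ι → F)) :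
    Continuous fun β : F => ∫ x, Φ x * psiSqPi ψ (fun i => β * c i) x ∂(Measure.pi fun _ : ι => μ) := by
  haveI : SecondCountableTopology F := secondCountableTopology_localField F
  have hint := integrable_of_mem_schwartzBruhat_pi μ hψ hΦ
  refine continuous_of_dominated (bound := fun x => ‖Φ x‖) (fun β => ?_) (fun β => Eventually.of_forall fun x => ?_)
    hint.norm (Eventually.of_forall fun x => ?_)
  · exact (integrable_mul_psiSqPi_of_mem_schwartzBruhat μ hψ c hΦ β).aestronglyMeasurable
  · rw [norm_mul, norm_psiSqPi, mul_one]
  · refine continuous_const.mul ?_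
    simp only [psiSqPi_apply]
    exact continuous_subtype_val.comp (hψ.comp (continuous_finsetSum _ fun i _ =>
      (continuous_id.mul continuous_const).mul continuous_const))

omit [MeasurableSpace F] [BorelSpace F] in
/-- `q / (√q)^r < 1` for `r ≥ 3` (the ratio of the shell series: shell mass `q^k` against decay `(√q)^{-rk}`).
[folklore] -/
private theorem ratio_lt_one {r : ℕ} (hr : 3 ≤ r) :
    (residueFieldCard F : ℝ) / Real.sqrt (residueFieldCard F) ^ r < 1 := by
  set sq : ℝ := Real.sqrt (residueFieldCard F) with hsq
  have hsq1 : 1 < sq := one_lt_sqrt_residueFieldCard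
  have hq : (residueFieldCard F : ℝ) = sq ^ 2 := (Real.sq_sqrt (Nat.cast_nonneg _)).symm
  rw [div_lt_one (pow_pos (zero_lt_one.trans hsq1) r), hq]
  exact pow_lt_pow_right₀ hsq1 (by omega)

/-- **the Gauss transform of a Schwartz–Bruhat function is integrable when `r = card ι ≥ 3`** (Weil's condition for
the rank-one hermitian case is `m > 2`): `‖G_Φ(β)‖ ≤ C ‖β‖^{-r/2}` is summed over the shells `‖β‖ = q^k` of mass
`∝ q^k`, a geometric series of ratio `q^{1 - r/2} < 1`. [cite: Weil1965, Chap. I n° 2, pp. 8–9] -/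
theorem integrable_integral_mul_psiSqPi {d : ℤ} (hd : ψ.HasConductorExp d) {v₂ : ℤ}
    (h2 : normAbs F (2 : F) = (residueFieldCard F : ℝ≥0)⁻¹ ^ v₂) {c : ι → F} (hc : ∀ i, c i ≠ 0)
    {Φ : (ι → F) → ℂ} (hΦ : Φ ∈ SchwartzBruhat (ι → F)) (hr : 3 ≤ Fintype.card ι) :
    Integrable (fun β : F => ∫ x, Φ x * psiSqPi ψ (fun i => β * c i) x ∂(Measure.pi fun _ : ι => μ)) μ := by
  set G : F → ℂ := fun β => ∫ x, Φ x * psiSqPi ψ (fun i => β * c i) x ∂(Measure.pi fun _ : ι => μ) with hGdef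
  have hψ : Continuous ψ := continuous_of_hasConductorExp hd
  have hcont : Continuous G := continuous_integral_mul_psiSqPi μ hψ c hΦ
  obtain ⟨C, hC0, hC⟩ := exists_norm_integral_mul_psiSqPi_le_of_mem_schwartzBruhat μ hd h2 hc hΦ
  set C₀ : ℝ := ∫ x, ‖Φ x‖ ∂(Measure.pi fun _ : ι => μ) with hC₀def
  have hC₀0 : 0 ≤ C₀ := integral_nonneg fun _ => norm_nonneg _
  have hGC₀ : ∀ β, ‖G β‖ ≤ C₀ := fun β =>
    norm_integral_mul_psiSqPi_le μ c (integrable_of_mem_schwartzBruhat_pi μ hψ hΦ) β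
  -- constants
  set q : ℝ := (residueFieldCard F : ℝ) with hqdef
  have hq1 : 1 < q := by rw [hqdef]; exact_mod_cast one_lt_residueFieldCard F
  have hq0 : 0 < q := zero_lt_one.trans hq1
  set sq : ℝ := Real.sqrt (residueFieldCard F) with hsqdef
  have hsq0 : 0 < sq := sqrt_residueFieldCard_pos
  set r : ℕ := Fintype.card ι with hrdef
  set ρ : ℝ := q / sq ^ r with hρdef
  have hρ0 : 0 ≤ ρ := div_nonneg hq0.le (pow_nonneg hsq0.le _)
  have hρ1 : ρ < 1 := ratio_lt_one hr
  set μ0 : ℝ := μ.real (primePowBall F 0) with hμ0def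
  have hμ0 : 0 ≤ μ0 := measureReal_nonneg
  set M : ℝ := max (C₀ * μ0) (C * μ0) with hMdef
  have hM0 : 0 ≤ M := le_max_of_le_left (mul_nonneg hC₀0 hμ0)
  -- the pieces: `T 0 = 𝒪`, `T (k+1) =` the shell `‖β‖ = q^{k+1}`
  set T : ℕ → Set F := fun k => if k = 0 then primePowBall F 0 else
    primePowBall F (-(k : ℤ)) \ primePowBall F (-(k : ℤ) + 1) with hTdef
  have hcover : (Set.univ : Set F) ⊆ ⋃ k, T k := by
    intro β _
    by_cases hβ : β ∈ primePowBall F 0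
    · exact Set.mem_iUnion.2 ⟨0, by rw [hTdef]; simpa using hβ⟩
    · have hβ0 : β ≠ 0 := by rintro rfl; exact hβ (zero_mem_primePowBall 0)
      obtain ⟨m, hm⟩ := exists_normAbs_eq_inv_zpow hβ0
      have hm0 : m < 0 := by
        by_contra h
        push Not at h
        exact hβ (by rw [mem_primePowBall_iff, hm]; exact inv_residueFieldCard_zpow_le_iff.2 h)
      refine Set.mem_iUnion.2 ⟨(-m).toNat, ?_⟩
      have hk : ((-m).toNat : ℤ) = -m := Int.toNat_of_nonneg (by omega)
      have hne : (-m).toNat ≠ 0 := by omega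
      rw [hTdef]
      simp only [hne, if_false]
      rw [hk, neg_neg, LocalFieldHaar.mem_shell_iff]
      exact hm
  -- bounds on each piece
  have hbound : ∀ k, ∫⁻ β in T k, ‖G β‖ₑ ∂μ ≤ ENNReal.ofReal M * ENNReal.ofReal ρ ^ k := by
    intro k
    rcases Nat.eq_zero_or_pos k with rfl | hk
    · rw [pow_zero, mul_one]
      have hT0 : T 0 = primePowBall F 0 := by rw [hTdef]; simp
      rw [hT0]
      calc ∫⁻ β in primePowBall F 0, ‖G β‖ₑ ∂μ ≤ ∫⁻ _ in primePowBall F 0, ENNReal.ofReal C₀ ∂μ :=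
            setLIntegral_mono' (measurableSet_primePowBall 0) fun β _ => by
              rw [← ofReal_norm]; exact ENNReal.ofReal_le_ofReal (hGC₀ β)
        _ = ENNReal.ofReal C₀ * μ (primePowBall F 0) := setLIntegral_const _ _
        _ = ENNReal.ofReal (C₀ * μ0) := by
            rw [hμ0def, measureReal_def, ENNReal.ofReal_mul hC₀0,
              ENNReal.ofReal_toReal (measure_primePowBall_lt_top μ 0).ne]
        _ ≤ ENNReal.ofReal M := ENNReal.ofReal_le_ofReal (le_max_left _ _)
    · obtain ⟨k', rfl⟩ : ∃ k', k = k' + 1 := ⟨k - 1, by omega⟩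
      have hTk : T (k' + 1) = primePowBall F (-((k' + 1 : ℕ) : ℤ)) \ primePowBall F (-((k' + 1 : ℕ) : ℤ) + 1) := by
        rw [hTdef]; simp
      rw [hTk]
      -- on the shell `‖β‖ = (q⁻¹)^{-(k'+1)}`: `‖G β‖ ≤ C sq^{r·(-(k'+1))}`
      have hGk : ∀ β ∈ primePowBall F (-((k' + 1 : ℕ) : ℤ)) \ primePowBall F (-((k' + 1 : ℕ) : ℤ) + 1),
          ‖G β‖ ≤ C * (sq ^ r)⁻¹ ^ (k' + 1) := by
        intro β hβ
        rw [LocalFieldHaar.mem_shell_iff] at hβ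
        have h := hC β _ hβ
        rw [show ((Fintype.card ι : ℤ) * -((k' + 1 : ℕ) : ℤ)) = -(((r * (k' + 1) : ℕ) : ℤ)) by
          rw [hrdef]; push_cast; ring, zpow_neg, zpow_natCast, pow_mul] at h
        rwa [inv_pow]
      have hμk : μ (primePowBall F (-((k' + 1 : ℕ) : ℤ)) \ primePowBall F (-((k' + 1 : ℕ) : ℤ) + 1)) ≤
          ENNReal.ofReal (q ^ (k' + 1) * μ0) := by
        calc μ (primePowBall F (-((k' + 1 : ℕ) : ℤ)) \ primePowBall F (-((k' + 1 : ℕ) : ℤ) + 1))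
            ≤ μ (primePowBall F (-((k' + 1 : ℕ) : ℤ))) := measure_mono Set.sdiff_subset
          _ = ENNReal.ofReal (μ.real (primePowBall F (-((k' + 1 : ℕ) : ℤ)))) :=
              (ENNReal.ofReal_toReal (measure_primePowBall_lt_top μ _).ne).symm
          _ = ENNReal.ofReal (q ^ (k' + 1) * μ0) := by
              rw [LocalFieldHaar.measureReal_primePowBall μ, hqdef, hμ0def, zpow_neg, zpow_natCast, inv_pow, inv_inv]
      calc ∫⁻ β in primePowBall F (-((k' + 1 : ℕ) : ℤ)) \ primePowBall F (-((k' + 1 : ℕ) : ℤ) + 1), ‖G β‖ₑ ∂μ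
          ≤ ∫⁻ _ in primePowBall F (-((k' + 1 : ℕ) : ℤ)) \ primePowBall F (-((k' + 1 : ℕ) : ℤ) + 1),
              ENNReal.ofReal (C * (sq ^ r)⁻¹ ^ (k' + 1)) ∂μ :=
            setLIntegral_mono' (LocalFieldHaar.measurableSet_shell _) fun β hβ => by
              rw [← ofReal_norm]; exact ENNReal.ofReal_le_ofReal (hGk β hβ)
        _ = ENNReal.ofReal (C * (sq ^ r)⁻¹ ^ (k' + 1)) *
              μ (primePowBall F (-((k' + 1 : ℕ) : ℤ)) \ primePowBall F (-((k' + 1 : ℕ) : ℤ) + 1)) :=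
            setLIntegral_const _ _
        _ ≤ ENNReal.ofReal (C * (sq ^ r)⁻¹ ^ (k' + 1)) * ENNReal.ofReal (q ^ (k' + 1) * μ0) := by
            gcongr
        _ = ENNReal.ofReal (C * μ0) * ENNReal.ofReal ρ ^ (k' + 1) := by
            rw [← ENNReal.ofReal_pow hρ0, ← ENNReal.ofReal_mul (by positivity), ← ENNReal.ofReal_mul (by positivity),
              hρdef, div_eq_mul_inv, mul_pow]
            ring_nf
        _ ≤ ENNReal.ofReal M * ENNReal.ofReal ρ ^ (k' + 1) := by
            gcongr
            exact le_max_right _ _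
  -- assemble
  refine ⟨hcont.aestronglyMeasurable, ?_⟩
  rw [hasFiniteIntegral_iff_enorm]
  calc ∫⁻ β, ‖G β‖ₑ ∂μ = ∫⁻ β in Set.univ, ‖G β‖ₑ ∂μ := by rw [Measure.restrict_univ]
    _ ≤ ∫⁻ β in ⋃ k, T k, ‖G β‖ₑ ∂μ := lintegral_mono_set hcover
    _ ≤ ∑' k, ∫⁻ β in T k, ‖G β‖ₑ ∂μ := lintegral_iUnion_le _ _
    _ ≤ ∑' k, ENNReal.ofReal M * ENNReal.ofReal ρ ^ k := ENNReal.tsum_le_tsum hbound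
    _ = ENNReal.ofReal M * (1 - ENNReal.ofReal ρ)⁻¹ := by rw [ENNReal.tsum_mul_left, ENNReal.tsum_geometric]
    _ < ∞ := by
        refine ENNReal.mul_lt_top ENNReal.ofReal_lt_top (ENNReal.inv_lt_top.2 ?_)
        rw [tsub_pos_iff_lt, ENNReal.ofReal_lt_one]
        exact hρ1

end GaussTransform

end Literature.NumberTheory.Weil1965
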